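import Literature.MathematicalPhysics.StatisticalMechanics.PeriodicRieszKernelFourier
import Literature.Barriers.AtomisticToContinuum.FeynmanCyclesVersusCondensationProofs
import Mathlib.Analysis.SpecialFunctions.ImproperIntegrals
import HarnessLib

/-!
# The periodic Riesz kernel: the self-energy bound, uniform in the period

For the smeared, zero-mean, `Lℤ³`-periodic Riesz-`s` kernel
`g = Literature.MathematicalPhysics.StatisticalMechanics.periodicRieszKernel s L η`
(`PeriodicRieszKernel.lean`; analytic API in `PeriodicRieszKernelFourier.lean`) we prove the
**self-energy bound**

  `0 ≤ g(0) ≤ C_s η^{-s}`  and hence  `0 ≤ g(0) - g(z) ≤ 2 C_s η^{-s}`   (`0 < s`, `0 < L`, `0 < η`),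

with a constant depending on `s` only — UNIFORMLY IN THE PERIOD `L` (the last clause of route item
`RieszKernelPositiveType` of `AtomisticToContinuum/BECRieszShadow`; Lewin 2022, Serfaty 2024
Ch. 3–4 for the role of the truncation scale `η`). This is where `s > 0` enters: for `s ≤ 0` the
same integral grows like `log(L/η)` (`s = 0`) or `L^{|s|}`.

## Proof

`g(0) = K_s ∫_{η²}^∞ t^{(1-s)/2} Θ_{L,t}(0) dt` with `Θ_{L,t}(0) = Σ_{m ∈ ℤ³} G_t(Lm) - L⁻³ ≥ 0`, and
two bounds on `Θ_{L,t}(0)`: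
* Gaussian side, small times `t ≤ L²`: `Θ_{L,t}(0) ≤ Σ_m G_t(Lm) = ((4πt)^{-1/2} Σ_{n ∈ ℤ} e^{-L²n²/4t})³`
  and `Σ_{n ∈ ℤ} e^{-cn²} ≤ 1 + 2/c` (geometric series; reused from the tree,
  `Literature.Barriers.AtomisticToContinuum.BoseGas.IdealGas.tsum_exp_neg_mul_intSq_le`), whence
  `Θ_{L,t}(0) ≤ 729 (4πt)^{-3/2}` (`periodicHeatSum_zero_le_rpow`);
* Fourier side, large times `t ≥ L²`: `Θ_{L,t}(0) = L⁻³ Σ_{k ≠ 0} e^{-4π²|k|²t/L²} ≤ L⁻³ C₁ e^{4π²} e^{-4π²t/L²}`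
  with `C₁ = Σ_{k ∈ ℤ³} e^{-4π²|k|²} - 1` (`periodicHeatSum_zero_le_exp`).
Then `∫_{η²}^∞ t^{(1-s)/2} · 729(4πt)^{-3/2} dt = 729 (4π)^{-3/2} (2/s) η^{-s}`, and on `[max(η², L²), ∞)`,
`t^{(1-s)/2} e^{-4π²t/L²} ≤ M^{(1-s)/2} e^{-2π²t/L²}` (`M = max(η², L²)`) integrates to at most
`(C₁ e^{4π²} / 2π²) η^{-s}` in both regimes `η ≤ L` and `L ≤ η` (`setIntegral_exp_bound_le`).
All constants are explicit; no named fact is introduced.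
-/

noncomputable section

namespace Literature.MathematicalPhysics.StatisticalMechanics

open MeasureTheory Set Filter Real
open scoped _root_.Topology
open Literature.Analysis.UnboundedOperators Literature.Analysis.FunctionSpaces
open Literature.MathematicalPhysics.QuantumManyBody.BoseGas

/-! ## Gaussian-side bound on `Θ_{L,t}(0)` for small times -/

/-- **The diagonal lattice sum**: `Σ_{m ∈ ℤ³} G_t(-Lm) = ((4πt)^{-1/2} Σ_{n ∈ ℤ} e^{-(L²/4t) n²})³`.
[folklore] -/
theorem tsum_heatKernel_neg_latticeVec_eq {L t : ℝ} (hL : 0 < L) (ht : 0 < t) :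
    ∑' m : Fin 3 → ℤ, heatKernel t (0 - latticeVec L m) =
      ((4 * π * t) ^ (-(1 / 2 : ℝ)) * ∑' n : ℤ, Real.exp (-(L ^ 2 / (4 * t) * (n : ℝ) ^ 2))) ^ 3 := by
  have h : ∀ i : Fin 3,
      (∑' n : ℤ, Real.exp (-((0 : EuclideanSpace ℝ (Fin 3)) i - L * n) ^ 2 / (4 * t))) =
        ∑' n : ℤ, Real.exp (-(L ^ 2 / (4 * t) * (n : ℝ) ^ 2)) := by
    intro i
    refine tsum_congr fun n => ?_
    congr 1
    simp only [WithLp.ofLp_zero, Pi.zero_apply, zero_sub]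
    ring
  rw [tsum_heatKernel_sub_latticeVec_eq_prod hL ht 0,
    Finset.prod_congr rfl fun i _ => congrArg (fun S => (4 * π * t) ^ (-(1 / 2 : ℝ)) * S) (h i),
    Finset.prod_const, Finset.card_univ, Fintype.card_fin]

/-- For `L, t > 0`: `Σ_{m ∈ ℤ³} G_t(-Lm) ≤ ((4πt)^{-1/2} (1 + 8t/L²))³`. [folklore] -/
theorem tsum_heatKernel_neg_latticeVec_le {L t : ℝ} (hL : 0 < L) (ht : 0 < t) :
    ∑' m : Fin 3 → ℤ, heatKernel t (0 - latticeVec L m) ≤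
      ((4 * π * t) ^ (-(1 / 2 : ℝ)) * (1 + 8 * t / L ^ 2)) ^ 3 := by
  rw [tsum_heatKernel_neg_latticeVec_eq hL ht]
  have hc : 0 < L ^ 2 / (4 * t) := by positivity
  have h1 := Literature.Barriers.AtomisticToContinuum.BoseGas.IdealGas.tsum_exp_neg_mul_intSq_le hc
  have h2 : (1 : ℝ) + 2 / (L ^ 2 / (4 * t)) = 1 + 8 * t / L ^ 2 := by
    field_simp
    ring
  rw [h2] at h1
  have h0 : 0 ≤ ∑' n : ℤ, Real.exp (-(L ^ 2 / (4 * t) * (n : ℝ) ^ 2)) :=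
    tsum_nonneg fun n => (Real.exp_pos _).le
  exact pow_le_pow_left₀ (by positivity) (mul_le_mul_of_nonneg_left h1 (by positivity)) 3

/-- **Small-time bound**: for `0 < t ≤ L²`, `Θ_{L,t}(0) ≤ 729 (4π)^{-3/2} t^{-3/2}`
(drop `-L⁻³`, use the previous bound with `1 + 8t/L² ≤ 9`). [folklore] -/
theorem periodicHeatSum_zero_le_rpow {L t : ℝ} (hL : 0 < L) (ht : 0 < t) (htL : t ≤ L ^ 2) :
    periodicHeatSum L t 0 ≤ 729 * (4 * π) ^ (-(3 / 2 : ℝ)) * t ^ (-(3 / 2 : ℝ)) := by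
  have h9 : 1 + 8 * t / L ^ 2 ≤ 9 := by
    have : 8 * t / L ^ 2 ≤ 8 := by
      rw [div_le_iff₀ (by positivity)]
      nlinarith
    linarith
  have hA : 0 ≤ (4 * π * t) ^ (-(1 / 2 : ℝ)) := by positivity
  calc periodicHeatSum L t 0 = (∑' m : Fin 3 → ℤ, heatKernel t (0 - latticeVec L m)) - 1 / L ^ 3 := rfl
    _ ≤ ∑' m : Fin 3 → ℤ, heatKernel t (0 - latticeVec L m) := by
        have : 0 ≤ 1 / L ^ 3 := by positivity
        linarith
    _ ≤ ((4 * π * t) ^ (-(1 / 2 : ℝ)) * (1 + 8 * t / L ^ 2)) ^ 3 := tsum_heatKernel_neg_latticeVec_le hL ht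
    _ ≤ ((4 * π * t) ^ (-(1 / 2 : ℝ)) * 9) ^ 3 :=
        pow_le_pow_left₀ (by positivity) (mul_le_mul_of_nonneg_left h9 hA) 3
    _ = 729 * (4 * π) ^ (-(3 / 2 : ℝ)) * t ^ (-(3 / 2 : ℝ)) := by
        rw [mul_pow, ← Real.rpow_natCast, ← Real.rpow_mul (by positivity),
          Real.mul_rpow (by positivity) ht.le]
        norm_num
        ring

/-! ## Fourier-side bound on `Θ_{L,t}(0)` for large times -/

/-- **Large-time bound**: for `t ≥ L²`, `Θ_{L,t}(0) ≤ L⁻³ C₁ e^{4π²} e^{-4π²t/L²}` with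
`C₁ = Σ_{k ∈ ℤ³} e^{-4π²|k|²} - 1`. [folklore] -/
theorem periodicHeatSum_zero_le_mul_exp {L t : ℝ} (hL : 0 < L) (hLt : L ^ 2 ≤ t) :
    periodicHeatSum L t 0 ≤ (L ^ 3)⁻¹ * (((∑' k : Fin 3 → ℤ, Torus.heatCoeff 1 k) - 1) *
      Real.exp (4 * π ^ 2)) * Real.exp (-(4 * π ^ 2 / L ^ 2) * t) := by
  have hE : Real.exp (-(4 * π ^ 2 * (t / L ^ 2 - 1))) =
      Real.exp (4 * π ^ 2) * Real.exp (-(4 * π ^ 2 / L ^ 2) * t) := by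
    rw [← Real.exp_add]
    congr 1
    field_simp
    ring
  calc periodicHeatSum L t 0 ≤ _ := periodicHeatSum_zero_le_exp hL hLt
    _ = _ := by rw [hE]; ring

/-! ## The time integral -/

/-- Pointwise: for `0 < M ≤ t`, `0 < c` and `a ≤ cM/2`, `t^a e^{-ct} ≤ M^a e^{-ct/2}`
(for `a ≤ 0` by monotonicity; for `a > 0` from `log u ≤ u - 1`). [folklore] -/
theorem rpow_mul_exp_neg_le {a c M t : ℝ} (hM : 0 < M) (hMt : M ≤ t) (hc : 0 < c)
    (ha : a ≤ c * M / 2) :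
    t ^ a * Real.exp (-c * t) ≤ M ^ a * Real.exp (-(c / 2) * t) := by
  have ht : 0 < t := hM.trans_le hMt
  have key : (t / M) ^ a ≤ Real.exp (c / 2 * t) := by
    rcases le_or_gt a 0 with ha0 | ha0
    · calc (t / M) ^ a ≤ 1 := Real.rpow_le_one_of_one_le_of_nonpos
            ((one_le_div hM).2 hMt) ha0
        _ ≤ Real.exp (c / 2 * t) := Real.one_le_exp (by positivity)
    · rw [Real.rpow_def_of_pos (by positivity), Real.exp_le_exp]
      have h1 : Real.log (t / M) ≤ t / M - 1 := Real.log_le_sub_one_of_pos (by positivity)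
      have h2 : a / M ≤ c / 2 := by
        rw [div_le_iff₀ hM]
        linarith
      calc Real.log (t / M) * a ≤ (t / M - 1) * a := mul_le_mul_of_nonneg_right h1 ha0.le
        _ ≤ t / M * a := by nlinarith
        _ = a / M * t := by ring
        _ ≤ c / 2 * t := mul_le_mul_of_nonneg_right h2 ht.le
  have hsplit : t ^ a = M ^ a * (t / M) ^ a := by
    rw [Real.div_rpow ht.le hM.le, mul_div_cancel₀ _ (Real.rpow_pos_of_pos hM a).ne']
  rw [hsplit, mul_assoc]
  refine mul_le_mul_of_nonneg_left ?_ (Real.rpow_nonneg hM.le a)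
  calc (t / M) ^ a * Real.exp (-c * t) ≤ Real.exp (c / 2 * t) * Real.exp (-c * t) :=
        mul_le_mul_of_nonneg_right key (Real.exp_pos _).le
    _ = Real.exp (-(c / 2) * t) := by rw [← Real.exp_add]; congr 1; ring

/-- `u e^{-2π²u²} ≤ 1` for every real `u`. [folklore] -/
theorem mul_exp_neg_two_pi_sq_mul_sq_le_one (u : ℝ) :
    u * Real.exp (-(2 * π ^ 2 * u ^ 2)) ≤ 1 := by
  have hπ : (1 : ℝ) ≤ 2 * π ^ 2 := by nlinarith [Real.two_le_pi]
  have h1 : u ≤ 2 * π ^ 2 * u ^ 2 + 1 := by nlinarith [sq_nonneg (u - 1), sq_nonneg u]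
  have h2 : 2 * π ^ 2 * u ^ 2 + 1 ≤ Real.exp (2 * π ^ 2 * u ^ 2) := Real.add_one_le_exp _
  rw [Real.exp_neg]
  have h3 : 0 < Real.exp (2 * π ^ 2 * u ^ 2) := Real.exp_pos _
  rw [mul_inv_le_iff₀ h3, one_mul]
  linarith

/-- **The large-time contribution**: with `M = max(η², L²)` and `c = 4π²/L²`,
`L⁻³ M^{(1-s)/2} ∫_{η²}^∞ e^{-ct/2} dt ≤ (2π²)⁻¹ η^{-s}` for `0 < s`, `0 < L`, `0 < η`
(cases `η ≤ L`: the integral is `≤ 2/c` and `L^{-s} ≤ η^{-s}`; `L ≤ η`: the factor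
`(η/L) e^{-2π²η²/L²} ≤ 1`). [folklore] -/
theorem setIntegral_exp_bound_le {s L η : ℝ} (hs : 0 < s) (hL : 0 < L) (hη : 0 < η) :
    (L ^ 3)⁻¹ * (max (η ^ 2) (L ^ 2)) ^ ((1 - s) / 2) *
        ∫ t in Ioi (η ^ 2), Real.exp (-(4 * π ^ 2 / L ^ 2 / 2) * t) ≤
      (2 * π ^ 2)⁻¹ * η ^ (-s) := by
  have hc : 0 < 4 * π ^ 2 / L ^ 2 / 2 := by positivity
  rw [integral_exp_mul_Ioi (by linarith) (η ^ 2)]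
  have h1 : -(4 * π ^ 2 / L ^ 2 / 2) * η ^ 2 = -(2 * π ^ 2 * (η / L) ^ 2) := by
    field_simp
    ring
  have hk : (4 * π ^ 2 / L ^ 2 / 2)⁻¹ = L ^ 2 / (2 * π ^ 2) := by
    rw [inv_div, div_div_eq_mul_div]
    ring
  have hI : -Real.exp (-(4 * π ^ 2 / L ^ 2 / 2) * η ^ 2) / -(4 * π ^ 2 / L ^ 2 / 2) =
      L ^ 2 / (2 * π ^ 2) * Real.exp (-(2 * π ^ 2 * (η / L) ^ 2)) := by
    rw [neg_div_neg_eq, h1, div_eq_inv_mul, hk]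
  rw [hI]
  rcases le_total η L with hηL | hLη
  · -- `η ≤ L`: `M = L²`
    have hM : max (η ^ 2) (L ^ 2) = L ^ 2 := max_eq_right (pow_le_pow_left₀ hη.le hηL 2)
    rw [hM]
    have hpow : (L ^ 3)⁻¹ * (L ^ 2) ^ ((1 - s) / 2) * (L ^ 2 / (2 * π ^ 2)) =
        (2 * π ^ 2)⁻¹ * L ^ (-s) := by
      rw [show (L ^ 2 : ℝ) = L ^ (2 : ℝ) by norm_cast, ← Real.rpow_mul hL.le,
        show (L ^ 3 : ℝ) = L ^ (3 : ℝ) by norm_cast, ← Real.rpow_neg hL.le]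
      have : L ^ (-(3 : ℝ)) * L ^ (2 * ((1 - s) / 2)) * L ^ (2 : ℝ) = L ^ (-s) := by
        rw [← Real.rpow_add hL, ← Real.rpow_add hL]
        congr 1
        ring
      calc L ^ (-(3 : ℝ)) * L ^ (2 * ((1 - s) / 2)) * (L ^ (2 : ℝ) / (2 * π ^ 2))
          = (2 * π ^ 2)⁻¹ * (L ^ (-(3 : ℝ)) * L ^ (2 * ((1 - s) / 2)) * L ^ (2 : ℝ)) := by ring
        _ = _ := by rw [this]
    calc (L ^ 3)⁻¹ * (L ^ 2) ^ ((1 - s) / 2) *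
          (L ^ 2 / (2 * π ^ 2) * Real.exp (-(2 * π ^ 2 * (η / L) ^ 2)))
        = (2 * π ^ 2)⁻¹ * L ^ (-s) * Real.exp (-(2 * π ^ 2 * (η / L) ^ 2)) := by
          rw [← hpow]; ring
      _ ≤ (2 * π ^ 2)⁻¹ * L ^ (-s) * 1 := by
          refine mul_le_mul_of_nonneg_left ?_ (by positivity)
          rw [Real.exp_le_one_iff]
          have : 0 ≤ 2 * π ^ 2 * (η / L) ^ 2 := by positivity
          linarith
      _ ≤ (2 * π ^ 2)⁻¹ * η ^ (-s) := by
          rw [mul_one]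
          exact mul_le_mul_of_nonneg_left
            (Real.rpow_le_rpow_of_nonpos hη hηL (by linarith)) (by positivity)
  · -- `L ≤ η`: `M = η²`
    have hM : max (η ^ 2) (L ^ 2) = η ^ 2 := max_eq_left (pow_le_pow_left₀ hL.le hLη 2)
    rw [hM]
    have hpow : (L ^ 3)⁻¹ * (η ^ 2) ^ ((1 - s) / 2) * (L ^ 2 / (2 * π ^ 2)) =
        (2 * π ^ 2)⁻¹ * η ^ (-s) * (η / L) := by
      rw [show (η ^ 2 : ℝ) = η ^ (2 : ℝ) by norm_cast, ← Real.rpow_mul hη.le]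
      have : η ^ (2 * ((1 - s) / 2)) = η ^ (-s) * η := by
        rw [show 2 * ((1 - s) / 2) = -s + 1 by ring, Real.rpow_add hη, Real.rpow_one]
      rw [this]
      field_simp
    calc (L ^ 3)⁻¹ * (η ^ 2) ^ ((1 - s) / 2) *
          (L ^ 2 / (2 * π ^ 2) * Real.exp (-(2 * π ^ 2 * (η / L) ^ 2)))
        = (2 * π ^ 2)⁻¹ * η ^ (-s) * ((η / L) * Real.exp (-(2 * π ^ 2 * (η / L) ^ 2))) := by
          rw [← mul_assoc, hpow]; ring
      _ ≤ (2 * π ^ 2)⁻¹ * η ^ (-s) * 1 :=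
          mul_le_mul_of_nonneg_left (mul_exp_neg_two_pi_sq_mul_sq_le_one _) (by positivity)
      _ = (2 * π ^ 2)⁻¹ * η ^ (-s) := mul_one _

/-- **The self-energy bound, explicit form**: for `0 < s`, `0 < L`, `0 < η`,
`g(0) ≤ K_s (729 (4π)^{-3/2} (2/s) + C₁ e^{4π²}/(2π²)) η^{-s}` with
`C₁ = Σ_{k ∈ ℤ³} e^{-4π²|k|²} - 1` — a bound UNIFORM IN `L`. [folklore] -/
theorem periodicRieszKernel_zero_le {s L η : ℝ} (hs : 0 < s) (hL : 0 < L) (hη : 0 < η) :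
    periodicRieszKernel s L η 0 ≤ rieszSubordinationConst s *
      (729 * (4 * π) ^ (-(3 / 2 : ℝ)) * (2 / s) +
        ((∑' k : Fin 3 → ℤ, Torus.heatCoeff 1 k) - 1) * Real.exp (4 * π ^ 2) / (2 * π ^ 2)) *
      η ^ (-s) := by
  have hη2 : 0 < η ^ 2 := by positivity
  have hK := rieszSubordinationConst_pos hs
  -- notation
  set a : ℝ := (1 - s) / 2 with ha
  set c : ℝ := 4 * π ^ 2 / L ^ 2 with hc_def
  set M : ℝ := max (η ^ 2) (L ^ 2) with hM_def
  set A₁ : ℝ := 729 * (4 * π) ^ (-(3 / 2 : ℝ)) with hA₁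
  set C₁ : ℝ := (∑' k : Fin 3 → ℤ, Torus.heatCoeff 1 k) - 1 with hC₁
  set B : ℝ := (L ^ 3)⁻¹ * (C₁ * Real.exp (4 * π ^ 2)) with hB
  have hc : 0 < c := by positivity
  have hM : 0 < M := lt_max_of_lt_left hη2
  have hC₁0 : 0 ≤ C₁ := sub_nonneg.2 (Torus.one_le_tsum_heatCoeff one_pos)
  have hA₁0 : 0 ≤ A₁ := by positivity
  have hB0 : 0 ≤ B := by positivity
  -- the two majorants
  set F₁ : ℝ → ℝ := fun t => A₁ * t ^ (-1 - s / 2) with hF₁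
  set F₂ : ℝ → ℝ := fun t => B * M ^ a * Real.exp (-(c / 2) * t) with hF₂
  have hF₁0 : ∀ t, 0 < t → 0 ≤ F₁ t := fun t ht => by positivity
  have hF₂0 : ∀ t, 0 ≤ F₂ t := fun t => by positivity
  -- pointwise domination on `(η², ∞)`
  have hdom : ∀ t ∈ Ioi (η ^ 2), t ^ a * periodicHeatSum L t 0 ≤ F₁ t + F₂ t := by
    intro t ht
    have ht0 : 0 < t := hη2.trans ht
    rcases le_or_gt t (L ^ 2) with htL | htL
    · calc t ^ a * periodicHeatSum L t 0 ≤ t ^ a * (A₁ * t ^ (-(3 / 2 : ℝ))) :=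
            mul_le_mul_of_nonneg_left (periodicHeatSum_zero_le_rpow hL ht0 htL)
              (Real.rpow_nonneg ht0.le a)
        _ = F₁ t := by
            simp only [hF₁, ha]
            rw [mul_left_comm, ← Real.rpow_add ht0]
            congr 2
            ring
        _ ≤ F₁ t + F₂ t := le_add_of_nonneg_right (hF₂0 t)
    · have hMt : M ≤ t := max_le (le_of_lt ht) (le_of_lt htL)
      have haM : a ≤ c * M / 2 := by
        have h1 : a ≤ 1 / 2 := by rw [ha]; linarith
        have h2 : (1 : ℝ) / 2 ≤ c * M / 2 := by
          have h3 : c * L ^ 2 = 4 * π ^ 2 := by rw [hc_def]; field_simp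
          have h4 : c * L ^ 2 ≤ c * M := mul_le_mul_of_nonneg_left (le_max_right _ _) hc.le
          nlinarith [Real.two_le_pi]
        exact h1.trans h2
      calc t ^ a * periodicHeatSum L t 0 ≤ t ^ a * (B * Real.exp (-c * t)) :=
            mul_le_mul_of_nonneg_left (periodicHeatSum_zero_le_mul_exp hL (le_of_lt htL))
              (Real.rpow_nonneg ht0.le a)
        _ = B * (t ^ a * Real.exp (-c * t)) := by ring
        _ ≤ B * (M ^ a * Real.exp (-(c / 2) * t)) :=
            mul_le_mul_of_nonneg_left (rpow_mul_exp_neg_le hM hMt hc haM) hB0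
        _ = F₂ t := by simp only [hF₂]; ring
        _ ≤ F₁ t + F₂ t := le_add_of_nonneg_left (hF₁0 t ht0)
  -- integrability of the majorants
  have hF₁i : IntegrableOn F₁ (Ioi (η ^ 2)) :=
    (integrableOn_Ioi_rpow_of_lt (by linarith) hη2).const_mul A₁
  have hF₂i : IntegrableOn F₂ (Ioi (η ^ 2)) :=
    (exp_neg_integrableOn_Ioi (η ^ 2) (by positivity : 0 < c / 2)).const_mul (B * M ^ a)
  -- the integrals of the majorants
  have hI₁ : ∫ t in Ioi (η ^ 2), F₁ t = A₁ * (2 / s) * η ^ (-s) := by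
    have hs0 : s ≠ 0 := hs.ne'
    have hint1 : ∫ t in Ioi (η ^ 2), t ^ (-1 - s / 2) = 2 / s * η ^ (-s) := by
      rw [integral_Ioi_rpow_of_lt (by linarith) hη2,
        show (η ^ 2 : ℝ) = η ^ (2 : ℝ) by norm_cast, ← Real.rpow_mul hη.le,
        show (2 : ℝ) * (-1 - s / 2 + 1) = -s by ring, show (-1 - s / 2 + 1 : ℝ) = -(s / 2) by ring]
      field_simp
    simp only [hF₁]
    rw [integral_const_mul, hint1, hA₁]
    ring
  have hI₂ : ∫ t in Ioi (η ^ 2), F₂ t ≤ C₁ * Real.exp (4 * π ^ 2) / (2 * π ^ 2) * η ^ (-s) := by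
    simp only [hF₂]
    rw [integral_const_mul]
    have h := setIntegral_exp_bound_le hs hL hη
    rw [← hM_def] at h
    have hc2 : -(4 * π ^ 2 / L ^ 2 / 2) = -(c / 2) := by rw [hc_def]
    rw [hc2] at h
    calc B * M ^ a * ∫ t in Ioi (η ^ 2), Real.exp (-(c / 2) * t)
        = C₁ * Real.exp (4 * π ^ 2) *
            ((L ^ 3)⁻¹ * M ^ ((1 - s) / 2) * ∫ t in Ioi (η ^ 2), Real.exp (-(c / 2) * t)) := by
          simp only [hB, ha]; ring
      _ ≤ C₁ * Real.exp (4 * π ^ 2) * ((2 * π ^ 2)⁻¹ * η ^ (-s)) :=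
          mul_le_mul_of_nonneg_left h (by positivity)
      _ = _ := by ring
  -- assemble
  have hint : IntegrableOn (fun t => t ^ a * periodicHeatSum L t 0) (Ioi (η ^ 2)) :=
    integrableOn_rpow_mul_periodicHeatSum hL hη.ne' a 0
  have hmain : ∫ t in Ioi (η ^ 2), t ^ a * periodicHeatSum L t 0 ≤
      (A₁ * (2 / s) + C₁ * Real.exp (4 * π ^ 2) / (2 * π ^ 2)) * η ^ (-s) := by
    calc ∫ t in Ioi (η ^ 2), t ^ a * periodicHeatSum L t 0
        ≤ ∫ t in Ioi (η ^ 2), (F₁ t + F₂ t) :=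
          setIntegral_mono_on hint (hF₁i.add hF₂i) measurableSet_Ioi hdom
      _ = (∫ t in Ioi (η ^ 2), F₁ t) + ∫ t in Ioi (η ^ 2), F₂ t := integral_add hF₁i hF₂i
      _ ≤ A₁ * (2 / s) * η ^ (-s) + C₁ * Real.exp (4 * π ^ 2) / (2 * π ^ 2) * η ^ (-s) := by
          rw [hI₁]; linarith [hI₂]
      _ = _ := by ring
  calc periodicRieszKernel s L η 0
      = rieszSubordinationConst s * ∫ t in Ioi (η ^ 2), t ^ a * periodicHeatSum L t 0 := rfl
    _ ≤ rieszSubordinationConst s *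
        ((A₁ * (2 / s) + C₁ * Real.exp (4 * π ^ 2) / (2 * π ^ 2)) * η ^ (-s)) :=
          mul_le_mul_of_nonneg_left hmain hK.le
    _ = _ := by simp only [hA₁, hC₁]; ring

/-- **Self-energy bound, uniform in the period** (Lewin 2022; Serfaty 2024, Ch. 3–4: the smeared
Riesz self-energy is `O(η^{-s})`): for every `s > 0` there is `C = C(s) > 0` with
`0 ≤ g(0) ≤ C η^{-s}` for ALL `L > 0`, `η > 0`. [folklore] -/
theorem exists_periodicRieszKernel_zero_le {s : ℝ} (hs : 0 < s) :
    ∃ C : ℝ, 0 < C ∧ ∀ L η : ℝ, 0 < L → 0 < η →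
      0 ≤ periodicRieszKernel s L η 0 ∧ periodicRieszKernel s L η 0 ≤ C * η ^ (-s) := by
  have hC₁0 : 0 ≤ (∑' k : Fin 3 → ℤ, Torus.heatCoeff 1 k) - 1 :=
    sub_nonneg.2 (Torus.one_le_tsum_heatCoeff one_pos)
  refine ⟨rieszSubordinationConst s * (729 * (4 * π) ^ (-(3 / 2 : ℝ)) * (2 / s) +
      ((∑' k : Fin 3 → ℤ, Torus.heatCoeff 1 k) - 1) * Real.exp (4 * π ^ 2) / (2 * π ^ 2)), ?_,
    fun L η hL hη => ⟨periodicRieszKernel_zero_nonneg hs hL hη.ne', ?_⟩⟩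
  · have hK := rieszSubordinationConst_pos hs
    positivity
  · exact periodicRieszKernel_zero_le hs hL hη

/-- **The self-energy estimate of route item `RieszKernelPositiveType`**: for every `s > 0`
there is `C = C(s) > 0` such that for ALL `L > 0`, `η > 0` and `z ∈ ℝ³`,
`g(0) - g(z) ≤ C η^{-s}` (indeed `0 ≤ g(0) - g(z) ≤ 2 g(0) ≤ C η^{-s}`). [folklore] -/
theorem exists_periodicRieszKernel_zero_sub_le {s : ℝ} (hs : 0 < s) :
    ∃ C : ℝ, 0 < C ∧ ∀ L η : ℝ, 0 < L → 0 < η → ∀ z : EuclideanSpace ℝ (Fin 3),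
      periodicRieszKernel s L η 0 - periodicRieszKernel s L η z ≤ C * η ^ (-s) := by
  obtain ⟨C, hC, h⟩ := exists_periodicRieszKernel_zero_le hs
  refine ⟨2 * C, by positivity, fun L η hL hη z => ?_⟩
  have h1 := (periodicRieszKernel_zero_sub_mem_Icc hs hL hη.ne' z).2
  have h2 := (h L η hL hη).2
  calc periodicRieszKernel s L η 0 - periodicRieszKernel s L η z
      ≤ 2 * periodicRieszKernel s L η 0 := h1
    _ ≤ 2 * (C * η ^ (-s)) := by gcongr
    _ = 2 * C * η ^ (-s) := by ring

end Literature.MathematicalPhysics.StatisticalMechanics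

end
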